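import Mathlib
import Literature.Analysis.FluidPDE.VectorCalculus

/-!
# Dilation covariance WITH CORE RESCALING of the crux's binders and the SCALING MODE of the linearised map
# (crux `Clause13RNearStraightL`, stmt-NavierStokesRegularity-23612; line `rate_bordered_split`, stubs `stub_rateRow13RFlat` /
# `stub_clamped13JBordered`; also `SkeletonJ1R` stmt-23610)

Route `FilamentSkeletonRss`, Variant A1R.  Third exact symmetry-bookkeeping file of this hand (after `…Clause13TranslationCovariance` — translations,
eigenvalue `½` — and `…Clause13RotationCovariance` of fsrs-3-g0 — the rotation orbit, eigenvalue `0`).  The matched Biot–Savart binder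
`hu : u Z y = Σ_k (Γγ_k/4π) • ∫ ((‖y − Z k σ‖² + κ·Aa k σ)^{3/2})⁻¹ • (Z_k′σ × (y − Z k σ)) dσ` is NOT dilation invariant at fixed cores, but it is
EXACTLY covariant when the cores are rescaled with the square of the dilation factor:

* `biotSavart_dilation` — with `u'` the binder for the cores `λ²·Aa`: **`u' (λ•Z) (λ•y) = λ⁻¹ • u Z y`** (`λ > 0`, `κ ≥ 0`, `Aa ≥ 0`; the integrands agree
  pointwise: `(λ²B)^{3/2} = λ³B^{3/2}`, `(λZ)′ × λr = λ²(Z′ × r)`; no integrability needed);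
* `nproj_smul_tangent` — the binder's normal projector is invariant under rescaling the tangent: `P_{λt} = P_t` (`λ ≠ 0`; junk-consistent at `t = 0`);
* `tangencyDefect_dilation` — **`T' (λ•Z) j τ = λ⁻¹ • T Z j τ + (λ − λ⁻¹) • K₁(Z) j τ`**, `K₁(Z) j τ := P_t(½ Z_jτ − α e₃ × Z_jτ)` the SCALING MODE
  (`T'` the tangency-defect binder over `u'`): the similarity strain `½y` and the rotation `−α e₃×y` scale with `λ`, the induction with `λ⁻¹`;
* `tangencyDefect_dilation_of_tangent` — at a tangent station (`T Z j τ = 0`, clause 8) the dilated skeleton with dilated cores has defect EXACTLY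
  `(λ − λ⁻¹) • K₁(Z) j τ`; since `d/dλ (λ − λ⁻¹)|_{λ=1} = 2` and `d/dλ (λ•Z)|_{λ=1} = Z`, this is the finite form of the heuristic eigen-relation
  «`DT·(generator of scaling) = 1 · (scaling mode)`» up to the CORE-VARIATION direction (the cores move with `λ²`), which is why the scaling mode is an
  eigenvalue-`1` direction only modulo a core term in clause currency (memo STRUCTURE-23612-conformal-cokernel-leafhand8-g1.md §3, evidence #29/#30
  on 23612: the conformal weight is `3/2`, so neither this mode nor the translations/rotation furnish an exact annihilator for STUB R).

Hand `leafhand-ns-filamentskeletonrs-8-g1` (LAND-ONLY); `--supports stmt-NavierStokesRegularity-23612` helper.  HONEST FRAMING: symmetry bookkeeping for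
a HYPOTHETICAL filament skeleton on the NEGATIVE side of a MODEL blow-up route; neither stub nor the crux is proved here, and nothing in this file bears
on Navier–Stokes regularity or blow-up.
-/

noncomputable section

open scoped InnerProductSpace BigOperators
open MeasureTheory
open Literature.Analysis.FluidPDE

namespace Summit.NavierStokesRegularity.NavierStokesRegularity.Theorems.Clause13DilationCovariance
set_option linter.dupNamespace false

/-! ## §1 Algebra -/

/-- Dilating a parametrised curve multiplies its derivative — unconditionally (real scalars form a field). [folklore] -/
theorem deriv_const_smul_vec (Z : ℝ → EuclideanSpace ℝ (Fin 3)) (lam σ : ℝ) :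
    deriv (fun s => lam • Z s) σ = lam • deriv Z σ :=
  deriv_fun_const_smul_field lam Z

/-- `(λ² B)^{3/2} = λ³ B^{3/2}` for `λ > 0`, `B ≥ 0`. [folklore] -/
theorem rpow_threeHalves_dilate {lam B : ℝ} (hlam : 0 < lam) (hB : 0 ≤ B) :
    (lam ^ 2 * B) ^ (3 / 2 : ℝ) = lam ^ 3 * B ^ (3 / 2 : ℝ) := by
  rw [Real.mul_rpow (sq_nonneg lam) hB]
  congr 1
  rw [show (lam ^ 2 : ℝ) = lam ^ (2 : ℝ) by norm_cast, ← Real.rpow_mul hlam.le]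
  norm_num

/-- The binder's normal projector is invariant under rescaling the tangent: `(⟪V, λt⟫/‖λt‖²)•(λt) = (⟪V,t⟫/‖t‖²)•t` (`λ ≠ 0`). [folklore] -/
theorem nproj_smul_tangent (V t : EuclideanSpace ℝ (Fin 3)) {lam : ℝ} (hlam : lam ≠ 0) :
    (⟪V, lam • t⟫_ℝ / ‖lam • t‖ ^ 2) • (lam • t) = (⟪V, t⟫_ℝ / ‖t‖ ^ 2) • t := by
  rw [real_inner_smul_right, norm_smul, mul_pow, Real.norm_eq_abs, sq_abs, smul_smul]
  congr 1
  have h2 : lam ^ 2 ≠ 0 := pow_ne_zero 2 hlam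
  by_cases ht : ‖t‖ = 0
  · simp [ht]
  · field_simp

/-- Additivity and homogeneity of the normal projector `P_t V = V − (⟪V,t⟫/‖t‖²)•t`. [folklore] -/
theorem nproj_add_smul (a b : ℝ) (V W t : EuclideanSpace ℝ (Fin 3)) :
    (a • V + b • W) - (⟪a • V + b • W, t⟫_ℝ / ‖t‖ ^ 2) • t
      = a • (V - (⟪V, t⟫_ℝ / ‖t‖ ^ 2) • t) + b • (W - (⟪W, t⟫_ℝ / ‖t‖ ^ 2) • t) := by
  rw [inner_add_left, real_inner_smul_left, real_inner_smul_left, add_div, add_smul, mul_div_assoc, mul_div_assoc,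
    ← smul_smul, ← smul_smul, smul_sub, smul_sub]
  abel

/-! ## §2 Dilation covariance with core rescaling -/

/-- **Dilation covariance of the matched Biot–Savart binder with cores rescaled by `λ²`**: `u' (λ•Z) (λ•y) = λ⁻¹ • u Z y`. [folklore] -/
theorem biotSavart_dilation {N : ℕ} {Γ κ lam : ℝ} {γ : Fin N → ℝ} {Aa : Fin N → ℝ → ℝ}
    {u u' : (Fin N → ℝ → EuclideanSpace ℝ (Fin 3)) → EuclideanSpace ℝ (Fin 3) → EuclideanSpace ℝ (Fin 3)}
    (hu : ∀ Z y, u Z y = ∑ k, (Γ * γ k / (4 * Real.pi)) • ∫ σ : ℝ,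
      ((‖y - Z k σ‖ ^ 2 + κ * Aa k σ) ^ (3 / 2 : ℝ))⁻¹ • cross (deriv (Z k) σ) (y - Z k σ))
    (hu' : ∀ Z y, u' Z y = ∑ k, (Γ * γ k / (4 * Real.pi)) • ∫ σ : ℝ,
      ((‖y - Z k σ‖ ^ 2 + κ * (lam ^ 2 * Aa k σ)) ^ (3 / 2 : ℝ))⁻¹ • cross (deriv (Z k) σ) (y - Z k σ))
    (hκ : 0 ≤ κ) (hA : ∀ k σ, 0 ≤ Aa k σ) (hlam : 0 < lam)
    (Z : Fin N → ℝ → EuclideanSpace ℝ (Fin 3)) (y : EuclideanSpace ℝ (Fin 3)) :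
    u' (fun k σ => lam • Z k σ) (lam • y) = lam⁻¹ • u Z y := by
  rw [hu, hu', Finset.smul_sum]
  refine Finset.sum_congr rfl fun k _ => ?_
  rw [smul_comm lam⁻¹ (Γ * γ k / (4 * Real.pi))]
  congr 1
  rw [← integral_smul]
  refine integral_congr_ae (Filter.Eventually.of_forall fun σ => ?_)
  have hcs : cross (deriv (fun s => lam • Z k s) σ) (lam • y - lam • Z k σ) = lam ^ 2 • cross (deriv (Z k) σ) (y - Z k σ) := by
    rw [deriv_const_smul_vec, ← smul_sub, ← crossCLM_apply, ContinuousLinearMap.map_smul₂, map_smul, crossCLM_apply,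
      smul_smul, sq]
  have hB : 0 ≤ ‖y - Z k σ‖ ^ 2 + κ * Aa k σ := add_nonneg (sq_nonneg _) (mul_nonneg hκ (hA k σ))
  have hbase : ‖lam • y - lam • Z k σ‖ ^ 2 + κ * (lam ^ 2 * Aa k σ) = lam ^ 2 * (‖y - Z k σ‖ ^ 2 + κ * Aa k σ) := by
    rw [← smul_sub, norm_smul, mul_pow, Real.norm_eq_abs, sq_abs]; ring
  simp only
  rw [hcs, hbase, rpow_threeHalves_dilate hlam hB, smul_smul, smul_smul]
  congr 1
  have hl : lam ≠ 0 := hlam.ne'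
  by_cases hB0 : (‖y - Z k σ‖ ^ 2 + κ * Aa k σ) ^ (3 / 2 : ℝ) = 0
  · simp [hB0]
  · field_simp

/-- **DILATION COVARIANCE OF THE TANGENCY DEFECT (cores rescaled)**: with `T'` the defect binder over `u'` (cores `λ²·Aa`),
`T' (λ•Z) j τ = λ⁻¹ • T Z j τ + (λ − λ⁻¹) • P_t(½ Z_jτ − α e₃ × Z_jτ)` — induction scales like `λ⁻¹`, strain and rotation like `λ`; the
difference is carried by the SCALING MODE `K₁ = P_t(½Z_j − α e₃×Z_j)`. [folklore] -/
theorem tangencyDefect_dilation {N : ℕ} {Γ κ lam α : ℝ} {γ : Fin N → ℝ} {Aa : Fin N → ℝ → ℝ}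
    {u u' : (Fin N → ℝ → EuclideanSpace ℝ (Fin 3)) → EuclideanSpace ℝ (Fin 3) → EuclideanSpace ℝ (Fin 3)}
    {T T' : (Fin N → ℝ → EuclideanSpace ℝ (Fin 3)) → Fin N → ℝ → EuclideanSpace ℝ (Fin 3)}
    (hu : ∀ Z y, u Z y = ∑ k, (Γ * γ k / (4 * Real.pi)) • ∫ σ : ℝ,
      ((‖y - Z k σ‖ ^ 2 + κ * Aa k σ) ^ (3 / 2 : ℝ))⁻¹ • cross (deriv (Z k) σ) (y - Z k σ))
    (hu' : ∀ Z y, u' Z y = ∑ k, (Γ * γ k / (4 * Real.pi)) • ∫ σ : ℝ,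
      ((‖y - Z k σ‖ ^ 2 + κ * (lam ^ 2 * Aa k σ)) ^ (3 / 2 : ℝ))⁻¹ • cross (deriv (Z k) σ) (y - Z k σ))
    (hT : ∀ Z j τ, T Z j τ = (u Z (Z j τ) + (1 / 2 : ℝ) • Z j τ - α • cross (EuclideanSpace.single 2 1) (Z j τ))
      - (⟪u Z (Z j τ) + (1 / 2 : ℝ) • Z j τ - α • cross (EuclideanSpace.single 2 1) (Z j τ), deriv (Z j) τ⟫_ℝ
          / ‖deriv (Z j) τ‖ ^ 2) • deriv (Z j) τ)
    (hT' : ∀ Z j τ, T' Z j τ = (u' Z (Z j τ) + (1 / 2 : ℝ) • Z j τ - α • cross (EuclideanSpace.single 2 1) (Z j τ))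
      - (⟪u' Z (Z j τ) + (1 / 2 : ℝ) • Z j τ - α • cross (EuclideanSpace.single 2 1) (Z j τ), deriv (Z j) τ⟫_ℝ
          / ‖deriv (Z j) τ‖ ^ 2) • deriv (Z j) τ)
    (hκ : 0 ≤ κ) (hA : ∀ k σ, 0 ≤ Aa k σ) (hlam : 0 < lam)
    (Z : Fin N → ℝ → EuclideanSpace ℝ (Fin 3)) (j : Fin N) (τ : ℝ) :
    T' (fun k σ => lam • Z k σ) j τ = lam⁻¹ • T Z j τ
      + (lam - lam⁻¹) • (((1 / 2 : ℝ) • Z j τ - α • cross (EuclideanSpace.single 2 1) (Z j τ))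
        - (⟪(1 / 2 : ℝ) • Z j τ - α • cross (EuclideanSpace.single 2 1) (Z j τ), deriv (Z j) τ⟫_ℝ / ‖deriv (Z j) τ‖ ^ 2)
          • deriv (Z j) τ) := by
  rw [hT', hT]
  beta_reduce
  rw [deriv_const_smul_vec (Z j) lam τ, biotSavart_dilation hu hu' hκ hA hlam Z (Z j τ)]
  set U := u Z (Z j τ) with hU
  set x := Z j τ with hx
  set t := deriv (Z j) τ with ht
  have hl : lam ≠ 0 := hlam.ne'
  -- the dilated similarity-frame velocity, split into the λ⁻¹ and (λ − λ⁻¹) parts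
  have hW : lam⁻¹ • U + (1 / 2 : ℝ) • (lam • x) - α • cross (EuclideanSpace.single 2 1) (lam • x)
      = lam⁻¹ • (U + (1 / 2 : ℝ) • x - α • cross (EuclideanSpace.single 2 1) x)
        + (lam - lam⁻¹) • ((1 / 2 : ℝ) • x - α • cross (EuclideanSpace.single 2 1) x) := by
    have hc : cross (EuclideanSpace.single 2 1) (lam • x) = lam • cross (EuclideanSpace.single 2 1) x := by
      rw [← crossCLM_apply, map_smul, crossCLM_apply]
    rw [hc]
    module
  rw [hW, nproj_smul_tangent _ t hl, nproj_add_smul]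

/-- **At a tangent station the dilated skeleton (cores dilated) has defect exactly `(λ − λ⁻¹)•K₁`.**  With clause 8 in `T`-language
(`T Z j τ = 0`), `T' (λ•Z) j τ = (λ − λ⁻¹) • P_t(½Z_jτ − α e₃×Z_jτ)`: the finite form of «the scaling mode is an eigenvalue-`1` direction modulo
the core variation» (`d/dλ (λ − λ⁻¹) = 2` at `λ = 1`, generator `Z ↦ Z` plus cores `Aa ↦ 2Aa`). [folklore] -/
theorem tangencyDefect_dilation_of_tangent {N : ℕ} {Γ κ lam α : ℝ} {γ : Fin N → ℝ} {Aa : Fin N → ℝ → ℝ}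
    {u u' : (Fin N → ℝ → EuclideanSpace ℝ (Fin 3)) → EuclideanSpace ℝ (Fin 3) → EuclideanSpace ℝ (Fin 3)}
    {T T' : (Fin N → ℝ → EuclideanSpace ℝ (Fin 3)) → Fin N → ℝ → EuclideanSpace ℝ (Fin 3)}
    (hu : ∀ Z y, u Z y = ∑ k, (Γ * γ k / (4 * Real.pi)) • ∫ σ : ℝ,
      ((‖y - Z k σ‖ ^ 2 + κ * Aa k σ) ^ (3 / 2 : ℝ))⁻¹ • cross (deriv (Z k) σ) (y - Z k σ))
    (hu' : ∀ Z y, u' Z y = ∑ k, (Γ * γ k / (4 * Real.pi)) • ∫ σ : ℝ,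
      ((‖y - Z k σ‖ ^ 2 + κ * (lam ^ 2 * Aa k σ)) ^ (3 / 2 : ℝ))⁻¹ • cross (deriv (Z k) σ) (y - Z k σ))
    (hT : ∀ Z j τ, T Z j τ = (u Z (Z j τ) + (1 / 2 : ℝ) • Z j τ - α • cross (EuclideanSpace.single 2 1) (Z j τ))
      - (⟪u Z (Z j τ) + (1 / 2 : ℝ) • Z j τ - α • cross (EuclideanSpace.single 2 1) (Z j τ), deriv (Z j) τ⟫_ℝ
          / ‖deriv (Z j) τ‖ ^ 2) • deriv (Z j) τ)
    (hT' : ∀ Z j τ, T' Z j τ = (u' Z (Z j τ) + (1 / 2 : ℝ) • Z j τ - α • cross (EuclideanSpace.single 2 1) (Z j τ))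
      - (⟪u' Z (Z j τ) + (1 / 2 : ℝ) • Z j τ - α • cross (EuclideanSpace.single 2 1) (Z j τ), deriv (Z j) τ⟫_ℝ
          / ‖deriv (Z j) τ‖ ^ 2) • deriv (Z j) τ)
    (hκ : 0 ≤ κ) (hA : ∀ k σ, 0 ≤ Aa k σ) (hlam : 0 < lam)
    {Z : Fin N → ℝ → EuclideanSpace ℝ (Fin 3)} {j : Fin N} {τ : ℝ} (h0 : T Z j τ = 0) :
    T' (fun k σ => lam • Z k σ) j τ
      = (lam - lam⁻¹) • (((1 / 2 : ℝ) • Z j τ - α • cross (EuclideanSpace.single 2 1) (Z j τ))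
        - (⟪(1 / 2 : ℝ) • Z j τ - α • cross (EuclideanSpace.single 2 1) (Z j τ), deriv (Z j) τ⟫_ℝ / ‖deriv (Z j) τ‖ ^ 2)
          • deriv (Z j) τ) := by
  rw [tangencyDefect_dilation hu hu' hT hT' hκ hA hlam Z j τ, h0, smul_zero, zero_add]

/-- In particular at `λ = 1` nothing changes (sanity check of the binder identity: `T' = T` pointwise when the cores agree). [folklore] -/
theorem tangencyDefect_dilation_one {N : ℕ} {Γ κ α : ℝ} {γ : Fin N → ℝ} {Aa : Fin N → ℝ → ℝ}
    {u u' : (Fin N → ℝ → EuclideanSpace ℝ (Fin 3)) → EuclideanSpace ℝ (Fin 3) → EuclideanSpace ℝ (Fin 3)}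
    {T T' : (Fin N → ℝ → EuclideanSpace ℝ (Fin 3)) → Fin N → ℝ → EuclideanSpace ℝ (Fin 3)}
    (hu : ∀ Z y, u Z y = ∑ k, (Γ * γ k / (4 * Real.pi)) • ∫ σ : ℝ,
      ((‖y - Z k σ‖ ^ 2 + κ * Aa k σ) ^ (3 / 2 : ℝ))⁻¹ • cross (deriv (Z k) σ) (y - Z k σ))
    (hu' : ∀ Z y, u' Z y = ∑ k, (Γ * γ k / (4 * Real.pi)) • ∫ σ : ℝ,
      ((‖y - Z k σ‖ ^ 2 + κ * ((1:ℝ) ^ 2 * Aa k σ)) ^ (3 / 2 : ℝ))⁻¹ • cross (deriv (Z k) σ) (y - Z k σ))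
    (hT : ∀ Z j τ, T Z j τ = (u Z (Z j τ) + (1 / 2 : ℝ) • Z j τ - α • cross (EuclideanSpace.single 2 1) (Z j τ))
      - (⟪u Z (Z j τ) + (1 / 2 : ℝ) • Z j τ - α • cross (EuclideanSpace.single 2 1) (Z j τ), deriv (Z j) τ⟫_ℝ
          / ‖deriv (Z j) τ‖ ^ 2) • deriv (Z j) τ)
    (hT' : ∀ Z j τ, T' Z j τ = (u' Z (Z j τ) + (1 / 2 : ℝ) • Z j τ - α • cross (EuclideanSpace.single 2 1) (Z j τ))
      - (⟪u' Z (Z j τ) + (1 / 2 : ℝ) • Z j τ - α • cross (EuclideanSpace.single 2 1) (Z j τ), deriv (Z j) τ⟫_ℝ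
          / ‖deriv (Z j) τ‖ ^ 2) • deriv (Z j) τ)
    (hκ : 0 ≤ κ) (hA : ∀ k σ, 0 ≤ Aa k σ)
    (Z : Fin N → ℝ → EuclideanSpace ℝ (Fin 3)) (j : Fin N) (τ : ℝ) :
    T' (fun k σ => (1:ℝ) • Z k σ) j τ = T Z j τ := by
  rw [tangencyDefect_dilation hu hu' hT hT' hκ hA one_pos Z j τ]
  simp

end Summit.NavierStokesRegularity.NavierStokesRegularity.Theorems.Clause13DilationCovariance

end
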